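import Literature.MathematicalPhysics.QuantumFieldTheory.Balaban1983to89.B8Eq1123ConcreteRec
import Literature.MathematicalPhysics.QuantumFieldTheory.Balaban1983to89.B8Eq1112QuotientRec
import Literature.MathematicalPhysics.QuantumFieldTheory.Balaban1983to89.B8SectERemainderCovariance

/-!
# `Balaban1983to89.B8SectERemainderCovarianceRec` — RECORD TWIN of `B8SectERemainderCovariance` §1–§3 ([Balaban1985RegularSpaces] Sect. E: the remainder
# `C′_j(u, ·)` of (1.115) under `μ ↦ −μ⋆`, via the `θ`-covariance `θ(w) = (w⋆)⁻¹` of the averaging operations (78)–(80), (178)–(179), (211)–(213) of [3])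
# for the SYMMETRISED CENTRED block averaging (0.4) of [Balaban1987RG1]

statement-level skeleton of published theorems with citation tags; proofs where landed; nothing here is a claim about the Yang–Mills mass gap

T. Bałaban, *Spaces of regular gauge field configurations on a lattice and gauge fixing conditions*, Commun. Math. Phys. **99** (1985) 75–102
`[Balaban1985RegularSpaces]` ("[6]"): (1.115) p. 96 and Sect. E pp. 96–97 (the reality of the fixed point — the gauge algebra is the SELF-ADJOINT part, so the
contraction must commute with `μ ↦ −μ⋆`); T. Bałaban, *Averaging operations for lattice gauge theories*, Commun. Math. Phys. **98** (1985) 17–51 `[Balaban1985Averaging]`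
("[3]"): (21)–(23) p. 21, (56)–(58) p. 27, (78)–(80) p. 30, (167) p. 44, (178)–(179) p. 45, (211)–(213) p. 50; T. Bałaban, *Renormalization group approach to lattice
gauge field theories. I*, Commun. Math. Phys. **109** (1987) 249–301 `[Balaban1987RG1]` ("[I]"): (0.3)–(0.4) pp. 252–253, pp. 253–254.  STATUS: published, refereed.

CITATION HEADER (lean-in-tree rule).  Cell `pub-ymgap`, base `pub-ymgap-dag-n05-c` g26 — N05-REC stage 2 (director-ym №254∕№255), item R5, LEAD PEN dag-n05-e
g35 (inventory `N05-REC-INVENTORY.md` e50db04501ab292d §R5 row `B8SectERemainderCovariance`: A `Cnl_negStar_inv_of_axial witness_inv_unitary_of_glev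
Cnl_negStar_of_witness Cnl_negStar utilG_theta lamAvgG_negStar uavg_theta` · C `R0avg_theta R0fun_theta` · B `savg_theta Sexp_theta`).  WHAT IS REPRODUCED = the
engine module ✓`B8SectERemainderCovariance` §1–§3 under the cell's TOKEN RULE: `avgIter ↦ avgIterZ`, block points `y + boxVec L r ↦ y + offZ L r`,
`Sexp ∕ savg ∕ R0avg ∕ uavg ↦ SexpZ ∕ savgZ ∕ R0avgZ ∕ uavgZ` (R0b-1), `Cond167 ∕ lamAvgG ∕ rlam ∕ utilG ↦ Cond167Z ∕ lamAvgGZ ∕ rlamZ ∕ utilGZ` (R0b-2),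
`Qnl ∕ Cnl ↦ QnlZ ∕ CnlZ` (this seat's `B8Eq178AveragesRec` ∕ `B8Eq1123ConcreteRec`); the engine's `R0fun_theta` is structure-free and REUSED BY NAME; its
PRIVATE `θ`-algebra (§1) is re-declared privately (same text).  Kind «kernel-checked proof», theorems only; no `instance`, no `notation`, no existing module
modified.  `--supports stmt-QuantumFields-20541` (K0⁷-keyed, COUNT-NEUTRAL).

## WHAT IS CERTIFIED HERE (kernel; axioms `propext` ∕ `Classical.choice` ∕ `Quot.sound`)
* §2 `SexpZ_theta`, `savgZ_theta`, `R0avgZ_theta`, `uavgZ_theta`, `utilGZ_theta`, `lamAvgGZ_negStar` — `θ`-covariance of the centred averaging operations.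
* §3 ★ `CnlZ_negStar` — `C′_j(u, −μ⋆)(z) = −C′_j(u, μ)(z)⋆`, GLOBAL FORM, record structure.

HONEST SCOPE: algebra of the exp-mean-log average and of the involution `θ`; NO inequality of [3]∕[6]∕[I]; the engine's §4 (`Cnl_negStar_of_witness`,
`witness_inv_unitary_of_glev`, `Cnl_negStar_inv_of_axial` — the TOWER-LOCAL forms over a unitary `Λ_j`-witness, resting on [3] Prop. 10 ∕ `glev` ∕ (1.106)) is NOT
twinned here (after the R1 ∕ R2 twins of `prop10_general_of52`, `inLambda_mul_of_prop10_general`, `glev_on_towers_of_axial`; APPEND-ONLY v1.1).  `HThm4Rec`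
UNDISCHARGED; caveat (C-S3-1) stands; N05 [B8] DISCHARGED OF RECORD untouched; COUNT 7∕28 (7∕27 excl. NODE O) · K 1∕4 UNMOVED; one finite `𝕋⁴` programme at fixed
`ε`, Bałaban AS PRINTED; nothing continuum ∕ ℝ⁴ ∕ OS ∕ mass-gap ∕ Clay.  No `sorry`, no `def`.

[cite: Balaban1985RegularSpaces, (1.115) p.96; Balaban1985Averaging, (21)–(23) p.21, (56)–(58) p.27, (78)–(80) p.30, (167) p.44, (178)–(179) p.45, (211)–(213) p.50; Balaban1987RG1, (0.3)–(0.4) pp.252–253]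
-/

noncomputable section

open NormedSpace Finset

namespace Literature.MathematicalPhysics.QuantumFieldTheory.Balaban1983to89.B8SectERemainderCovarianceRec

open B7Prop1Explicit B7Prop2Explicit B7Prop3Flat B7Prop1Local
open MatrixLog (mlog exp_mlog norm_mlog_le_two_mul)
open B7Eq170Flat (cj cj_apply val_Rc_eq_cj bmean bmean_apply)
open B7Eq92Concrete (Rc Rc_apply mgauge)
open B7Eq99Concrete (R0fun R0fun_apply R0fun_self R0fun_add)
open B7Eq78Linearization (QprimeIter)
open B9Eq3114Proof (mlog_units_inv)
open B8SectERemainderCovariance (R0fun_theta)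
open BlockAveragingZd (offZ avgIterZ)
open B7SectCDGaugeAveragesRec (SexpZ savgZ R0avgZ uavgZ uavgZ_zero uavgZ_succ)
open B7SectEFLinearisationRec (Cond167Z rlamZ lamAvgGZ lamAvgGZ_succ utilGZ zdBlockingZ bgTZ)
open B8Eq178AveragesRec (QnlZ QnlZ_eq_mlog_utilGZ qprimeIter_bgTZ_eq_lamAvgGZ utilGZ_eq_uavgZ_mul_inv)
open B7Eq99ConcreteRec (SexpZ_apply savgZ_apply)
open B8Eq1112QuotientRec (uavgZ_mem_unitaryUnits)
open B8Eq1123ConcreteRec (CnlZ)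

-- `Site` alone could resolve to the torus sites of `Setup.lean`; re-export the `ℤ^d` sites of `B7Prop1Explicit`.
export B7Prop1Explicit (Site)

variable {d : ℕ}
variable {𝔸 : Type*} [CStarAlgebra 𝔸]

/-! ## §1 The involution `θ(w) = (w⋆)⁻¹` of the unit group and the logarithm (the engine's private algebra, re-declared) -/

section Theta

omit [CStarAlgebra 𝔸] in
/-- `θ` is multiplicative: `((ab)⋆)⁻¹ = (a⋆)⁻¹(b⋆)⁻¹`. [folklore] -/
private theorem thetaU_mul {𝔹 : Type*} [Monoid 𝔹] [StarMul 𝔹] (a b : 𝔹ˣ) : (star (a * b))⁻¹ = (star a)⁻¹ * (star b)⁻¹ := by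
  rw [star_mul, mul_inv_rev]

omit [CStarAlgebra 𝔸] in
/-- `θ` commutes with inversion: `((a⁻¹)⋆)⁻¹ = ((a⋆)⁻¹)⁻¹`. [folklore] -/
private theorem thetaU_inv {𝔹 : Type*} [Monoid 𝔹] [StarMul 𝔹] (a : 𝔹ˣ) : (star a⁻¹)⁻¹ = ((star a)⁻¹)⁻¹ :=
  Units.ext (by rw [inv_inv, Units.coe_star, Units.coe_star_inv, inv_inv])

/-- A unitary unit has `h⋆ = h⁻¹` in `𝔸ˣ`. [folklore] -/
private theorem star_eq_inv_of_mem {h : 𝔸ˣ} (hh : h ∈ unitaryUnits 𝔸) : star h = h⁻¹ :=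
  Units.ext (by
    rw [Units.coe_star]
    exact (Units.inv_eq_of_mul_eq_one_left (Unitary.star_mul_self_of_mem (mem_unitaryUnits.1 hh))).symm)

/-- `θ(e^S) = e^{−S⋆}` (`NormedSpace.star_exp`). [cite: Balaban1985Averaging, (22)–(23) p.21] -/
private theorem thetaU_expUnit (S : 𝔸) : (star (expUnit S))⁻¹ = expUnit (-star S) :=
  Units.ext (by rw [Units.coe_star_inv, val_inv_expUnit, val_expUnit, val_expUnit, star_exp, star_neg])

/-- `log θ(W) = −(log W)⋆` on the domain of the logarithm: for a unit `W` with `‖W − 1‖ ≤ 1/8`, `log((W⋆)⁻¹) = −(log W)⋆`.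
[cite: Balaban1985Averaging, (21)–(23) p.21] -/
private theorem mlog_thetaU {W : 𝔸ˣ} (hW : ‖(W : 𝔸) - 1‖ ≤ 1 / 8) :
    mlog (((star W)⁻¹ : 𝔸ˣ) : 𝔸) = -star (mlog (W : 𝔸)) := by
  have hWinv : ‖((W⁻¹ : 𝔸ˣ) : 𝔸) - 1‖ ≤ 1 / 4 :=
    (B7Prop6Flat.norm_units_inv_sub_one_le W (hW.trans (by norm_num))).trans (by linarith)
  set X : 𝔸 := ((W⁻¹ : 𝔸ˣ) : 𝔸) with hX
  have hX1 : ‖X - 1‖ < 1 := lt_of_le_of_lt hWinv (by norm_num)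
  have hlogX : ‖mlog X‖ ≤ 1 / 2 := (norm_mlog_le_two_mul (hWinv.trans (by norm_num))).trans (by linarith)
  have hlog2 : (1 : ℝ) / 2 < Real.log 2 := by have := Real.log_two_gt_d9; linarith
  have hstar : mlog (star X) = star (mlog X) := by
    have h2 : star X = exp (star (mlog X)) := by rw [← star_exp, exp_mlog hX1]
    rw [h2]
    exact B7BlockAvgLog.mlog_exp (by rw [norm_star]; exact lt_of_le_of_lt hlogX hlog2)
  rw [Units.coe_star_inv, hstar, hX, mlog_units_inv (lt_of_le_of_lt hW (by norm_num)), star_neg]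

/-- `⋆` commutes with the rotation `cj h m = h m h⁻¹` by a UNITARY `h`. [cite: Balaban1985Averaging, (56) p.27] -/
private theorem star_cj {h : 𝔸ˣ} (hh : h ∈ unitaryUnits 𝔸) (m : 𝔸) : star (cj h m) = cj h (star m) := by
  have h1 : star ((h : 𝔸ˣ) : 𝔸) = ((h⁻¹ : 𝔸ˣ) : 𝔸) := by
    rw [← Units.coe_star, star_eq_inv_of_mem hh]
  have h2 : star ((h⁻¹ : 𝔸ˣ) : 𝔸) = ((h : 𝔸ˣ) : 𝔸) := by
    rw [← Units.coe_star, star_eq_inv_of_mem ((unitaryUnits 𝔸).inv_mem hh), inv_inv]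
  rw [cj_apply, cj_apply, star_mul, star_mul, h1, h2, mul_assoc]

omit [CStarAlgebra 𝔸] in
/-- Real scalars commute with `⋆`. [folklore] -/
private theorem star_smul_real_cstar {𝔹 : Type*} [CStarAlgebra 𝔹] (c : ℝ) (m : 𝔹) : star (c • m) = c • star m := by
  rw [RCLike.real_smul_eq_coe_smul (K := ℂ) c m, RCLike.real_smul_eq_coe_smul (K := ℂ) c (star m), star_smul, RCLike.star_def,
    RCLike.conj_ofReal]

end Theta

/-! ## §2 Covariance of the centred averaging operations (78)–(80), (178)–(179), (211)–(213) of [3] -/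

section Averaging

variable {L : ℕ}

/-- **The exponent of the centred (78) for `θ∘g` is `−(S_g)⋆`** (twin of `Sexp_theta`), when every `‖g(y)⁻¹g(x) − 1‖ ≤ 1/8` on the block.
[cite: Balaban1985Averaging, (78) p.30, (21) p.21; Balaban1987RG1, (0.3) p.252] -/
theorem SexpZ_theta {g : Site d → 𝔸ˣ} {y : Site d}
    (hW : ∀ r : Fin d → Fin L, ‖((((g y)⁻¹ * g (y + offZ L r) : 𝔸ˣ)) : 𝔸) - 1‖ ≤ 1 / 8) :
    SexpZ L (fun x => (star (g x))⁻¹) y = -star (SexpZ L g y) := by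
  rw [SexpZ_apply, SexpZ_apply, star_sum, ← sum_neg_distrib]
  refine sum_congr rfl fun r _ => ?_
  have hgrp : ((star (g y))⁻¹)⁻¹ * (star (g (y + offZ L r)))⁻¹ = (star ((g y)⁻¹ * g (y + offZ L r)))⁻¹ := by
    rw [thetaU_mul, thetaU_inv]
  rw [hgrp, mlog_thetaU (hW r), star_smul_real_cstar, smul_neg]

/-- **The centred site average (78) is `θ`-covariant** (twin of `savg_theta`): `{θ∘g}_{B(y)} = θ({g}_{B(y)})`, on the domain of the logarithms.
[cite: Balaban1985Averaging, (78) p.30] -/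
theorem savgZ_theta {g : Site d → 𝔸ˣ} {y : Site d}
    (hW : ∀ r : Fin d → Fin L, ‖((((g y)⁻¹ * g (y + offZ L r) : 𝔸ˣ)) : 𝔸) - 1‖ ≤ 1 / 8) :
    savgZ L (fun x => (star (g x))⁻¹) y = (star (savgZ L g y))⁻¹ := by
  rw [savgZ_apply, savgZ_apply, SexpZ_theta hW, thetaU_mul, thetaU_expUnit]

/-- **The centred twisted site average (78)∕(79) `R̄₀v` is `θ`-covariant at a unitary background** (twin of `R0avg_theta`), on the domain of the logarithms.
[cite: Balaban1985Averaging, (78)–(79) p.30] -/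
theorem R0avgZ_theta {V₀ : Site d → Fin d → 𝔸ˣ} (hV : ∀ x κ, V₀ x κ ∈ unitaryUnits 𝔸) {v : Site d → 𝔸ˣ} {y : Site d}
    (hW : ∀ r : Fin d → Fin L, ‖((((v y)⁻¹ * R0fun V₀ y v (y + offZ L r) : 𝔸ˣ)) : 𝔸) - 1‖ ≤ 1 / 8) :
    R0avgZ L V₀ (fun x => (star (v x))⁻¹) y = (star (R0avgZ L V₀ v y))⁻¹ := by
  rw [R0avgZ, R0avgZ, R0fun_theta hV]
  refine savgZ_theta (g := R0fun V₀ y v) fun r => ?_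
  rw [R0fun_self]
  exact hW r

variable {U₀ : Site d → Fin d → 𝔸ˣ} {u u' : Site d → 𝔸ˣ} {k : ℕ} {β β' η : ℝ}

/-- **The `k`-th order centred averages (79)–(80) are `θ`-covariant** (twin of `uavg_theta`): `\overline{R₀(θ∘u)}ʲ = θ ∘ \overline{R₀u}ʲ`, `j ≤ k`, for `u` satisfying
(167) with `βLᵏη ≤ 1/8` at a background with UNITARY averaged levels `Ū₀ʲ = avgIterZ L U₀ j` (`j < k`).
[cite: Balaban1985Averaging, (79)–(80) p.30, (167) p.44] -/
theorem uavgZ_theta (hV : ∀ j < k, ∀ (x : Site d) (κ : Fin d), avgIterZ L U₀ j x κ ∈ unitaryUnits 𝔸)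
    (h167 : Cond167Z L U₀ u k β η) (hL : 1 ≤ L) (hη : 0 ≤ η) (hβ : 0 ≤ β) (hs : β * (L : ℝ) ^ k * η ≤ 1 / 8) :
    ∀ j ≤ k, uavgZ L U₀ (fun x => (star (u x))⁻¹) j = fun z => (star (uavgZ L U₀ u j z))⁻¹ := by
  have hLr : (1 : ℝ) ≤ L := by exact_mod_cast hL
  intro j
  induction j with
  | zero => intro _; rfl
  | succ j ih =>
    intro hjk
    have hjlt : j < k := Nat.lt_of_succ_le hjk
    funext z
    rw [uavgZ_succ, ih hjlt.le, uavgZ_succ]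
    refine R0avgZ_theta (hV j hjlt) fun r => ?_
    rw [R0fun_add]
    calc ‖((((uavgZ L U₀ u j ((L : ℤ) • z))⁻¹ *
          Rc (hol (avgIterZ L U₀ j) ((L : ℤ) • z) (treeWord (offZ L r)))
            (uavgZ L U₀ u j ((L : ℤ) • z + offZ L r)) : 𝔸ˣ)) : 𝔸) - 1‖
        ≤ β * (L : ℝ) ^ (j + 1) * η := h167 j hjlt z r
      _ ≤ β * (L : ℝ) ^ k * η :=
        mul_le_mul_of_nonneg_right (mul_le_mul_of_nonneg_left (pow_le_pow_right₀ hLr hjk) hβ) hη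
      _ ≤ 1 / 8 := hs

/-- **The centred relative averages `ũ′ʲ` of (178)∕(179) are `θ`-covariant in `u′` for a UNITARY `u`** (twin of `utilG_theta`): `ũ′ʲ[θ∘u′, u] = θ ∘ ũ′ʲ[u′, u]`,
`j ≤ k` — by (178) (`utilGZ_eq_uavgZ_mul_inv`), `uavgZ_theta` for the product `u′u` ((167) with constant `β′`) and the unitarity of `\overline{R₀u}ʲ`
(`uavgZ_mem_unitaryUnits`, (167) for `u` with `β`). [cite: Balaban1985Averaging, (178)–(179) p.45, (79)–(80) p.30] -/
theorem utilGZ_theta (hV : ∀ j < k, ∀ (x : Site d) (κ : Fin d), avgIterZ L U₀ j x κ ∈ unitaryUnits 𝔸)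
    (hu : ∀ x, u x ∈ unitaryUnits 𝔸) (h167 : Cond167Z L U₀ u k β η) (h167' : Cond167Z L U₀ (u' * u) k β' η)
    (hL : 1 ≤ L) (hη : 0 ≤ η) (hβ : 0 ≤ β) (hβ' : 0 ≤ β') (hs : β * (L : ℝ) ^ k * η ≤ 1 / 4) (hs' : β' * (L : ℝ) ^ k * η ≤ 1 / 8) :
    ∀ j ≤ k, ∀ z : Site d, utilGZ L U₀ (fun x => (star (u' x))⁻¹) u j z = (star (utilGZ L U₀ u' u j z))⁻¹ := by
  intro j hj z
  have hprod : (fun x => (star (u' x))⁻¹) * u = fun x => (star ((u' * u) x))⁻¹ := by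
    funext x
    rw [Pi.mul_apply, Pi.mul_apply, thetaU_mul, star_eq_inv_of_mem (hu x), inv_inv]
  have hun : star (uavgZ L U₀ u j z) = (uavgZ L U₀ u j z)⁻¹ :=
    star_eq_inv_of_mem (uavgZ_mem_unitaryUnits hV hu h167 hL hη hβ hs j hj z)
  rw [congrFun (utilGZ_eq_uavgZ_mul_inv L U₀ _ u j) z, congrFun (utilGZ_eq_uavgZ_mul_inv L U₀ u' u j) z, hprod,
    congrFun (uavgZ_theta hV h167' hL hη hβ' hs' j hj) z, thetaU_mul, thetaU_inv, hun, inv_inv]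

/-- **The centred linear averaging `Q′_j` of (211)–(213) satisfies `Q′_j(−μ⋆) = −(Q′_jμ)⋆`** at a background with unitary averaged levels (twin of
`lamAvgG_negStar`): real weights and rotations by unitaries commute with `m ↦ −m⋆`. [cite: Balaban1985Averaging, (211)–(213) p.50, (56) p.27] -/
theorem lamAvgGZ_negStar (hV : ∀ j < k, ∀ (x : Site d) (κ : Fin d), avgIterZ L U₀ j x κ ∈ unitaryUnits 𝔸) (f : Site d → 𝔸) :
    ∀ j ≤ k, lamAvgGZ L U₀ j (fun x => -star (f x)) = fun z => -star (lamAvgGZ L U₀ j f z) := by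
  intro j
  induction j with
  | zero => intro _; rfl
  | succ j ih =>
    intro hjk
    have hjlt : j < k := Nat.lt_of_succ_le hjk
    funext z
    rw [lamAvgGZ_succ, ih hjlt.le, lamAvgGZ_succ]
    simp only [rlamZ, bmean_apply]
    rw [star_sum, ← sum_neg_distrib]
    refine sum_congr rfl fun r _ => ?_
    rw [B7Eq170Flat.cj_neg, star_smul_real_cstar, star_cj (hol_mem_of (hV j hjlt) _ _), smul_neg]

end Averaging

/-! ## §3 The Sect.-E remainder `C′_j(u, ·)` under `μ ↦ −μ⋆`, global form, record structure -/

section Global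

variable {L : ℕ} {U₀ : Site d → Fin d → 𝔸ˣ} {u : Site d → 𝔸ˣ} {k : ℕ} {β β' η : ℝ} {μ : Site d → 𝔸}

/-- ★ **`C′_j(u, −μ⋆)(z) = −C′_j(u, μ)(z)⋆`, GLOBAL FORM, record structure** (twin of `Cnl_negStar`) — for a UNITARY `u` with (167) (constant `β`, `βLᵏη ≤ ¼`), the
product `e^{μ}u` with (167) (constant `β′`, `β′Lᵏη ≤ 1/8`), unitary averaged levels of `U₀`, and the relative averages `ũ′ʲ(z)` of `(e^{μ}, u)` within `1/8` of `1`: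
`C′_j(u, −μ⋆) = log θ(ũ′ʲ) − Q′_j(−μ⋆) = −(log ũ′ʲ)⋆ + (Q′_jμ)⋆ = −C′_j(u, μ)⋆`. [cite: Balaban1985RegularSpaces, (1.115) p.96; Balaban1985Averaging, (213) p.50, (178)–(179) p.45] -/
theorem CnlZ_negStar (hV : ∀ j < k, ∀ (x : Site d) (κ : Fin d), avgIterZ L U₀ j x κ ∈ unitaryUnits 𝔸)
    (hu : ∀ x, u x ∈ unitaryUnits 𝔸) (h167 : Cond167Z L U₀ u k β η)
    (h167' : Cond167Z L U₀ ((fun x => expUnit (μ x)) * u) k β' η)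
    (hL : 1 ≤ L) (hη : 0 ≤ η) (hβ : 0 ≤ β) (hβ' : 0 ≤ β') (hs : β * (L : ℝ) ^ k * η ≤ 1 / 4) (hs' : β' * (L : ℝ) ^ k * η ≤ 1 / 8)
    (h204 : ∀ j ≤ k, ∀ z : Site d, ‖((utilGZ L U₀ (fun x => expUnit (μ x)) u j z : 𝔸ˣ) : 𝔸) - 1‖ ≤ 1 / 8) :
    ∀ j ≤ k, ∀ z : Site d, CnlZ L U₀ u j (fun x => -star (μ x)) z = -star (CnlZ L U₀ u j μ z) := by
  intro j hj z
  have hexp : (fun x => expUnit (-star (μ x))) = fun x => (star ((fun x => expUnit (μ x)) x))⁻¹ :=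
    funext fun x => (thetaU_expUnit (μ x)).symm
  simp only [CnlZ, QnlZ_eq_mlog_utilGZ, qprimeIter_bgTZ_eq_lamAvgGZ]
  rw [hexp, utilGZ_theta hV hu h167 h167' hL hη hβ hβ' hs hs' j hj z, mlog_thetaU (h204 j hj z),
    congrFun (lamAvgGZ_negStar hV μ j hj) z, star_sub]
  abel

end Global

end Literature.MathematicalPhysics.QuantumFieldTheory.Balaban1983to89.B8SectERemainderCovarianceRec

end
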